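import Summits.QuantumFields.YangMills.Theorems.LangevinControlUVOSLegsFromFemtoAndGapStubAssemblyMomentWeights
import HarnessLib

/-!
# Soft OS-assembly toolkit XI-a: the lattice one-, two- and three-point distributions vs `0`, `Q2`, `Q3`

Helper file for stub `stub_assembly`/`stub_assembly6` of crux `OSLegsFromFemtoAndGap` (stmt-QuantumFields-9367,
line `dlr-collar-transfer`): the non-triviality inputs `LowerBounds` are phrased with the bare smeared truncated
functions `Q2`, `Q3` of the route Defs file, the soft OS legs with the distributions `latticeDist` of toolkit III
(canonically centred at the torus mean).  Here: the centred one-point distribution vanishes identically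
(`torusMoment_one`, `latticeDist_one_apply`), the centred two-point weight is the covariance and the centred
three-point weight is the third cumulant `torusK3` (`torusMoment_two`, `torusMoment_three`), hence on real
tensors `latticeDist … 2 (u ⊗ v) = Q2 u v` and `latticeDist … 3 (f ⊗ g ⊗ h) = Q3 f g h`
(`latticeDist_two_tensor`, `latticeDist_three_tensor`).
-/

noncomputable section

open scoped SchwartzMap BigOperators
open MeasureTheory Filter Topology
open Literature.MathematicalPhysics.QuantumFieldTheory Literature.MathematicalPhysics.QuantumLattice
open Literature.MathematicalPhysics.AQFT
open Literature.Probability.LatticeModels (box Site)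
open Summit.QuantumFields.YangMills.Cruxes.OSLegsFromFemtoAndGap.DlrCollarTransfer (torusE dens torusK3 Q2 Q3)

namespace Summit.QuantumFields.YangMills.Theorems.OSLegsFromFemtoAndGap

local notation "E4" => EuclideanSpace ℝ (Fin 4)

variable {G : Type} [Group G] [TopologicalSpace G] [IsTopologicalGroup G] [CompactSpace G]
  [MeasurableSpace G] [BorelSpace G]

/-! ### Integrability of (products of) translated action densities on the torus -/

/-- The translated action density read through the periodic lift is integrable for Wilson's measure. -/
theorem integrable_dens_lift (r : LatticeRep G) (β : ℝ) (L : ℕ) (x : Site 4) :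
    Integrable (fun U : GaugeConfig 4 (2 * L + 1) G => dens G r x (torusLift (2 * L + 1) U))
      (wilsonMeasure (d := 4) (L := 2 * L + 1) r.ρ β) := by
  refine (integrable_prod_obs r β L r.curvature 0 (fun _ : Fin 1 => x)).congr
    (Eventually.of_forall fun U => ?_)
  simp only [Finset.univ_unique, Fin.default_eq_zero, Finset.prod_singleton, sub_zero]
  rfl

/-- Products of two translated action densities are integrable. -/
theorem integrable_dens_mul_dens_lift (r : LatticeRep G) (β : ℝ) (L : ℕ) (x y : Site 4) :
    Integrable (fun U : GaugeConfig 4 (2 * L + 1) G =>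
        dens G r x (torusLift (2 * L + 1) U) * dens G r y (torusLift (2 * L + 1) U))
      (wilsonMeasure (d := 4) (L := 2 * L + 1) r.ρ β) := by
  refine (integrable_prod_obs r β L r.curvature 0 ![x, y]).congr (Eventually.of_forall fun U => ?_)
  simp only [Fin.prod_univ_two, sub_zero]
  rfl

/-- Products of three translated action densities are integrable. -/
theorem integrable_dens_mul_dens_mul_dens_lift (r : LatticeRep G) (β : ℝ) (L : ℕ) (x y z : Site 4) :
    Integrable (fun U : GaugeConfig 4 (2 * L + 1) G =>
        dens G r x (torusLift (2 * L + 1) U) * dens G r y (torusLift (2 * L + 1) U) *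
          dens G r z (torusLift (2 * L + 1) U))
      (wilsonMeasure (d := 4) (L := 2 * L + 1) r.ρ β) := by
  refine (integrable_prod_obs r β L r.curvature 0 ![x, y, z]).congr (Eventually.of_forall fun U => ?_)
  simp only [Fin.prod_univ_three, sub_zero]
  rfl

/-! ### The centred one-, two-, three-point weights -/

/-- **The centred one-point weight vanishes** (canonical centring at the torus mean). -/
theorem torusMoment_one (r : LatticeRep G) (β : ℝ) (L : ℕ) (x : Fin 1 → Site 4) :
    torusMoment r.ρ β L r.curvature.F (wilsonTorusMean r.ρ β L r.curvature.F) x = 0 := by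
  haveI := isProbabilityMeasure_wilsonMeasure (d := 4) (L := 2 * L + 1) r.ρ r.continuous β
  have hm : ∫ U, r.curvature.F (configShift (-(x 0)) (torusLift (2 * L + 1) U))
      ∂(wilsonMeasure (d := 4) (L := 2 * L + 1) r.ρ β) = wilsonTorusMean r.ρ β L r.curvature.F :=
    torusE_dens_eq_wilsonTorusMean (G := G) r β L (x 0)
  have hiA : Integrable (fun U : GaugeConfig 4 (2 * L + 1) G =>
      r.curvature.F (configShift (-(x 0)) (torusLift (2 * L + 1) U)))
      (wilsonMeasure (d := 4) (L := 2 * L + 1) r.ρ β) := integrable_dens_lift r β L (x 0)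
  unfold torusMoment
  simp only [Finset.univ_unique, Fin.default_eq_zero, Finset.prod_singleton]
  rw [integral_sub hiA (integrable_const _), integral_const, hm]
  simp

/-- **The centred one-point lattice distribution vanishes.** -/
theorem latticeDist_one_apply (r : LatticeRep G) (β : ℝ) (L : ℕ) (a : ℝ) (F : 𝓢((Fin 1 → E4), ℂ)) :
    latticeDist r.ρ β L a r.curvature.F (wilsonTorusMean r.ρ β L r.curvature.F) 1 F = 0 := by
  rw [latticeDist_apply]
  refine Finset.sum_eq_zero fun x _ => ?_
  rw [torusMoment_one, Complex.ofReal_zero, zero_mul]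

/-- **The centred two-point weight is the covariance.** -/
theorem torusMoment_two (r : LatticeRep G) (β : ℝ) (L : ℕ) (x : Fin 2 → Site 4) :
    torusMoment r.ρ β L r.curvature.F (wilsonTorusMean r.ρ β L r.curvature.F) x =
      torusE G r β L (fun U => dens G r (x 0) U * dens G r (x 1) U) -
        torusE G r β L (dens G r (x 0)) * torusE G r β L (dens G r (x 1)) := by
  haveI := isProbabilityMeasure_wilsonMeasure (d := 4) (L := 2 * L + 1) r.ρ r.continuous β
  set m := wilsonTorusMean r.ρ β L r.curvature.F with hm
  have h0 := torusE_dens_eq_wilsonTorusMean (G := G) r β L (x 0)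
  have h1 := torusE_dens_eq_wilsonTorusMean (G := G) r β L (x 1)
  rw [h0, h1, ← hm]
  unfold torusMoment
  simp only [Fin.prod_univ_two]
  -- expand `(A − m)(B − m) = AB − m A − m B + m²` and integrate termwise
  set A := fun U : GaugeConfig 4 (2 * L + 1) G => dens G r (x 0) (torusLift (2 * L + 1) U) with hA
  set B := fun U : GaugeConfig 4 (2 * L + 1) G => dens G r (x 1) (torusLift (2 * L + 1) U) with hB
  have hiA : Integrable A _ := integrable_dens_lift r β L (x 0)
  have hiB : Integrable B _ := integrable_dens_lift r β L (x 1)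
  have hiAB : Integrable (fun U => A U * B U) _ := integrable_dens_mul_dens_lift r β L (x 0) (x 1)
  have hEA : ∫ U, A U ∂(wilsonMeasure (d := 4) (L := 2 * L + 1) r.ρ β) = m := by rw [hm, ← h0]; rfl
  have hEB : ∫ U, B U ∂(wilsonMeasure (d := 4) (L := 2 * L + 1) r.ρ β) = m := by rw [hm, ← h1]; rfl
  have hpt : (fun U : GaugeConfig 4 (2 * L + 1) G =>
      (r.curvature.F (configShift (-(x 0)) (torusLift (2 * L + 1) U)) - m) *
        (r.curvature.F (configShift (-(x 1)) (torusLift (2 * L + 1) U)) - m)) =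
      fun U => (A U * B U - m * A U) - (m * B U - m * m) := by
    funext U; simp only [hA, hB, dens]; ring
  have hi1 : Integrable (fun U => A U * B U - m * A U) (wilsonMeasure (d := 4) (L := 2 * L + 1) r.ρ β) :=
    hiAB.sub (hiA.const_mul m)
  have hi2 : Integrable (fun U => m * B U - m * m) (wilsonMeasure (d := 4) (L := 2 * L + 1) r.ρ β) :=
    (hiB.const_mul m).sub (integrable_const _)
  have hmA : Integrable (fun U => m * A U) (wilsonMeasure (d := 4) (L := 2 * L + 1) r.ρ β) := hiA.const_mul m
  have hmB : Integrable (fun U => m * B U) (wilsonMeasure (d := 4) (L := 2 * L + 1) r.ρ β) := hiB.const_mul m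
  rw [hpt, integral_sub hi1 hi2, integral_sub hiAB hmA, integral_sub hmB (integrable_const _),
    integral_const_mul, integral_const_mul, integral_const, hEA, hEB]
  simp only [probReal_univ, smul_eq_mul, one_mul]
  change _ = torusE G r β L (fun U => dens G r (x 0) U * dens G r (x 1) U) - m * m
  unfold torusE
  simp only [hA, hB]
  ring

/-- **The centred three-point weight is the third cumulant `torusK3`.** -/
theorem torusMoment_three (r : LatticeRep G) (β : ℝ) (L : ℕ) (x : Fin 3 → Site 4) :
    torusMoment r.ρ β L r.curvature.F (wilsonTorusMean r.ρ β L r.curvature.F) x =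
      torusK3 G r β L (x 0) (x 1) (x 2) := by
  haveI := isProbabilityMeasure_wilsonMeasure (d := 4) (L := 2 * L + 1) r.ρ r.continuous β
  set m := wilsonTorusMean r.ρ β L r.curvature.F with hm
  have h0 := torusE_dens_eq_wilsonTorusMean (G := G) r β L (x 0)
  have h1 := torusE_dens_eq_wilsonTorusMean (G := G) r β L (x 1)
  have h2 := torusE_dens_eq_wilsonTorusMean (G := G) r β L (x 2)
  unfold torusK3
  rw [h0, h1, h2, ← hm]
  unfold torusMoment
  simp only [Fin.prod_univ_three]
  set A := fun U : GaugeConfig 4 (2 * L + 1) G => dens G r (x 0) (torusLift (2 * L + 1) U) with hA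
  set B := fun U : GaugeConfig 4 (2 * L + 1) G => dens G r (x 1) (torusLift (2 * L + 1) U) with hB
  set C := fun U : GaugeConfig 4 (2 * L + 1) G => dens G r (x 2) (torusLift (2 * L + 1) U) with hC
  have hiAB : Integrable (fun U => A U * B U) _ := integrable_dens_mul_dens_lift r β L (x 0) (x 1)
  have hiAC : Integrable (fun U => A U * C U) _ := integrable_dens_mul_dens_lift r β L (x 0) (x 2)
  have hiBC : Integrable (fun U => B U * C U) _ := integrable_dens_mul_dens_lift r β L (x 1) (x 2)
  have hiA : Integrable A _ := integrable_dens_lift r β L (x 0)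
  have hiB : Integrable B _ := integrable_dens_lift r β L (x 1)
  have hiC : Integrable C _ := integrable_dens_lift r β L (x 2)
  have hiABC : Integrable (fun U => A U * B U * C U) _ :=
    integrable_dens_mul_dens_mul_dens_lift r β L (x 0) (x 1) (x 2)
  have hEA : ∫ U, A U ∂(wilsonMeasure (d := 4) (L := 2 * L + 1) r.ρ β) = m := by rw [hm, ← h0]; rfl
  have hEB : ∫ U, B U ∂(wilsonMeasure (d := 4) (L := 2 * L + 1) r.ρ β) = m := by rw [hm, ← h1]; rfl
  have hEC : ∫ U, C U ∂(wilsonMeasure (d := 4) (L := 2 * L + 1) r.ρ β) = m := by rw [hm, ← h2]; rfl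
  -- `(A−m)(B−m)(C−m) = ABC − m(AB + AC + BC) + m²(A + B + C) − m³`
  have hpt : (fun U : GaugeConfig 4 (2 * L + 1) G =>
      (r.curvature.F (configShift (-(x 0)) (torusLift (2 * L + 1) U)) - m) *
        (r.curvature.F (configShift (-(x 1)) (torusLift (2 * L + 1) U)) - m) *
        (r.curvature.F (configShift (-(x 2)) (torusLift (2 * L + 1) U)) - m)) =
      fun U => ((A U * B U * C U - m * (A U * B U + A U * C U + B U * C U)) +
        (m * m * (A U + B U + C U) - m * m * m)) := by
    funext U; simp only [hA, hB, hC, dens]; ring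
  have hS2 : Integrable (fun U => A U * B U + A U * C U + B U * C U)
      (wilsonMeasure (d := 4) (L := 2 * L + 1) r.ρ β) := (hiAB.add hiAC).add hiBC
  have hS1 : Integrable (fun U => A U + B U + C U) (wilsonMeasure (d := 4) (L := 2 * L + 1) r.ρ β) :=
    (hiA.add hiB).add hiC
  have hmS2 : Integrable (fun U => m * (A U * B U + A U * C U + B U * C U))
      (wilsonMeasure (d := 4) (L := 2 * L + 1) r.ρ β) := hS2.const_mul m
  have hmS1 : Integrable (fun U => m * m * (A U + B U + C U))
      (wilsonMeasure (d := 4) (L := 2 * L + 1) r.ρ β) := hS1.const_mul (m * m)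
  have hi1 : Integrable (fun U => A U * B U * C U - m * (A U * B U + A U * C U + B U * C U))
      (wilsonMeasure (d := 4) (L := 2 * L + 1) r.ρ β) := hiABC.sub hmS2
  have hi2 : Integrable (fun U => m * m * (A U + B U + C U) - m * m * m)
      (wilsonMeasure (d := 4) (L := 2 * L + 1) r.ρ β) := hmS1.sub (integrable_const _)
  have hAB_AC : Integrable (fun U => A U * B U + A U * C U) (wilsonMeasure (d := 4) (L := 2 * L + 1) r.ρ β) :=
    hiAB.add hiAC
  have hA_B : Integrable (fun U => A U + B U) (wilsonMeasure (d := 4) (L := 2 * L + 1) r.ρ β) := hiA.add hiB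
  rw [hpt, integral_add hi1 hi2, integral_sub hiABC hmS2, integral_sub hmS1 (integrable_const _),
    integral_const_mul, integral_const_mul, integral_add hAB_AC hiBC, integral_add hiAB hiAC,
    integral_add hA_B hiC, integral_add hiA hiB, integral_const, hEA, hEB, hEC]
  simp only [probReal_univ, smul_eq_mul, one_mul]
  unfold torusE
  simp only [hA, hB, hC]
  ring

/-! ### The two- and three-point distributions on real tensors are `Q2` and `Q3` -/

/-- Sums over `(box L)²` indexed by `Fin 2 → Site 4` are double sums. -/
theorem sum_piFinset_two {M : Type*} [AddCommMonoid M] (s : Finset (Site 4)) (φ : (Fin 2 → Site 4) → M) :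
    ∑ x ∈ Fintype.piFinset (fun _ : Fin 2 => s), φ x = ∑ p ∈ s, ∑ q ∈ s, φ ![p, q] := by
  rw [← Finset.sum_product']
  refine Finset.sum_bij' (fun x _ => (x 0, x 1)) (fun pq _ => ![pq.1, pq.2]) (fun x hx => ?_)
    (fun pq hpq => ?_) (fun x _ => ?_) (fun pq _ => ?_) (fun x _ => ?_)
  · simp only [Fintype.mem_piFinset] at hx
    exact Finset.mem_product.2 ⟨hx 0, hx 1⟩
  · rw [Finset.mem_product] at hpq
    simp only [Fintype.mem_piFinset]
    intro i; fin_cases i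
    · exact hpq.1
    · exact hpq.2
  · funext i; fin_cases i <;> rfl
  · rfl
  · congr 1; funext i; fin_cases i <;> rfl

/-- Sums over `(box L)³` indexed by `Fin 3 → Site 4` are triple sums. -/
theorem sum_piFinset_three {M : Type*} [AddCommMonoid M] (s : Finset (Site 4))
    (φ : (Fin 3 → Site 4) → M) :
    ∑ x ∈ Fintype.piFinset (fun _ : Fin 3 => s), φ x = ∑ p ∈ s, ∑ q ∈ s, ∑ w ∈ s, φ ![p, q, w] := by
  have h3 : ∑ p ∈ s, ∑ q ∈ s, ∑ w ∈ s, φ ![p, q, w] =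
      ∑ t ∈ s ×ˢ (s ×ˢ s), φ ![t.1, t.2.1, t.2.2] := by
    rw [Finset.sum_product]
    exact Finset.sum_congr rfl fun p _ => by rw [Finset.sum_product]
  rw [h3]
  refine Finset.sum_bij' (fun x _ => (x 0, (x 1, x 2))) (fun t _ => ![t.1, t.2.1, t.2.2]) (fun x hx => ?_)
    (fun t ht => ?_) (fun x _ => ?_) (fun t _ => ?_) (fun x _ => ?_)
  · simp only [Fintype.mem_piFinset] at hx
    exact Finset.mem_product.2 ⟨hx 0, Finset.mem_product.2 ⟨hx 1, hx 2⟩⟩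
  · rw [Finset.mem_product, Finset.mem_product] at ht
    simp only [Fintype.mem_piFinset]
    intro i; fin_cases i
    · exact ht.1
    · exact ht.2.1
    · exact ht.2.2
  · funext i; fin_cases i <;> rfl
  · rfl
  · congr 1; funext i; fin_cases i <;> rfl

/-- **`latticeDist … 2 (u ⊗ v) = Q2 u v`** for real test functions `u, v` (any tensor witness). -/
theorem latticeDist_two_tensor (r : LatticeRep G) (β : ℝ) (L : ℕ) (s : ℝ)
    (u v : 𝓢(E4, ℝ)) (F : 𝓢((Fin 2 → E4), ℂ)) (hF : IsTensorOf F (fun i => ofRealTest (![u, v] i))) :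
    latticeDist r.ρ β L s r.curvature.F (wilsonTorusMean r.ρ β L r.curvature.F) 2 F =
      (Q2 G r β L s u v : ℂ) := by
  rw [latticeDist_apply, sum_piFinset_two]
  unfold Q2
  push_cast
  refine Finset.sum_congr rfl fun p _ => Finset.sum_congr rfl fun q _ => ?_
  rw [hF, torusMoment_two, Fin.prod_univ_two]
  simp only [Matrix.cons_val_zero, Matrix.cons_val_one, ofRealTest_apply]
  push_cast
  ring

/-- **`latticeDist … 3 (f ⊗ g ⊗ h) = Q3 f g h`** for real test functions (any tensor witness). -/
theorem latticeDist_three_tensor (r : LatticeRep G) (β : ℝ) (L : ℕ) (s : ℝ)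
    (f g h : 𝓢(E4, ℝ)) (F : 𝓢((Fin 3 → E4), ℂ)) (hF : IsTensorOf F (fun i => ofRealTest (![f, g, h] i))) :
    latticeDist r.ρ β L s r.curvature.F (wilsonTorusMean r.ρ β L r.curvature.F) 3 F =
      (Q3 G r β L s f g h : ℂ) := by
  rw [latticeDist_apply, sum_piFinset_three]
  unfold Q3
  push_cast
  refine Finset.sum_congr rfl fun p _ => Finset.sum_congr rfl fun q _ => Finset.sum_congr rfl fun w _ => ?_
  rw [hF, torusMoment_three, Fin.prod_univ_three]
  simp only [Matrix.cons_val_zero, Matrix.cons_val_one, Matrix.cons_val, ofRealTest_apply]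
  ring

end Summit.QuantumFields.YangMills.Theorems.OSLegsFromFemtoAndGap

end
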